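import Summits.BirchSwinnertonDyer.Rank1Residual.X11b.RingClassFieldConj
import Literature.NumberTheory.EllipticCurves.RingClassFieldConjugation
import Literature.NumberTheory.EllipticCurves.ZhangLevelRaisedHeegnerData
import Literature.NumberTheory.EllipticCurves.ZpExtensionProofs
import HarnessLib

/-!
# Route `AdditiveKolyvaginRoad`, crux `LevelKolyvaginSystemsAdditive` (item stmt-BirchSwinnertonDyer-21396, KS′):
# GROSS'S FROBENIUS LIFT ACTS TRIVIALLY ON THE RING CLASS FIELD `K[ℓ]`
# (cell `pub/bsd-wall`, width seat `bsd-wall-akr-p2x-w3` g7; `--supports stmt-BirchSwinnertonDyer-21396`, helper; first input of the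
# local AXIS LEMMA at a Kolyvagin prime — «an isotropic ramified eigenclass is transverse» — which is the E-side content of the RAISE half
# of the twin dichotomy for the mixed level spaces, cf. `…LevelSystemsCanonicalLines` (Jump), `…LevelSystemsOfSelmerDichotomy` (K))

WHY. At a Kolyvagin prime `λ ∋ ℓ` (inert in the imaginary quadratic `K`), the tree's local analysis of eigenclasses
(`h1Eval_frob_eq_zero_of_cupProduct_self_eq_zero_P`, `exists_eq_zsmul_of_apply_frob_eq_zero_P`) is phrased at GROSS'S Frobenius lift
`F ∈ Γ_K` (`exists_frobeniusLift_of_isKolyvaginPrime`: `res_{ℚ} F = h²` for a Frobenius `h ∈ Γ_ℚ` at `ℓ` lifting the complex conjugation `c`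
of `K`). The TRANSVERSE condition (`transverseLocalKerP`, `Method2.transverseLocalCondition`) is «the cocycle vanishes on `Gal(K̄_λ/K[ℓ]_λ)`».
The bridge between the two is the classical fact that this particular lift FIXES `K[ℓ]` pointwise: `h|_{K[ℓ]}` lies in the non-trivial
coset of `𝒢_ℓ = Gal(K[ℓ]/K)` in the generalised dihedral group `Gal(K[ℓ]/ℚ)`, every element of that coset is an involution, and `F = h²`.

WHAT. §1 `mul_self_eq_one_of_not_mem_ringClassGal` — every `σ ∈ Aut_ℚ(K[n]) ∖ 𝒢_n` is an involution (from the tree's complex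
conjugation `τ` of `K[n]`, `Aut = 𝒢 ∪ τ𝒢`, and the dihedral relation `τ g τ⁻¹ = g⁻¹`). §2 `mem_ringClassStabilizer_of_absGaloisRestrict_eq_sq` —
for `F ∈ Γ_K` with `res_ℚ F = h²`, `h ∈ Γ_ℚ` lifting `c ≠ 1`: `F ∈ ringClassStabilizer K ι ℓ ℓ` (`F` fixes every `K`-embedded copy of `K[ℓ]`
in `K̄`): `F = t²` on `K̄` for the transport `t` of `h` (`absGaloisTransport_absGaloisRestrict`), `t ∘ e = e ∘ g₀` with `g₀ ∉ 𝒢_ℓ`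
(`RingClassConj.exists_algEquiv_forall_apply_eq`; `g₀` moves `K` because `t` does), and `g₀² = 1` by §1.

HONEST FRAMING: two theorems; 0 definitions, 0 named facts, 0 `sorry`; closes nothing. BSD is not proved by any of this.

References: [cite: GrossLMS1991, §3 (K_n Galois over ℚ, τ an involution; λ and K[ℓ])] [cite: Cox2013, §9.A Lemma 9.3]
[cite: WZhang2014, §8.1 (H¹_tr)].
-/

-- single-conjunct summit: `Summit.BirchSwinnertonDyer.BirchSwinnertonDyer.…` repeats the name by design
set_option linter.dupNamespace false

noncomputable section

open scoped Classical

namespace Summit.BirchSwinnertonDyer.BirchSwinnertonDyer.Theorems.AdditiveKoly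

open Field NumberField Literature.NumberTheory.EllipticCurves Literature.NumberTheory.GaloisRepresentations
  Summit.BirchSwinnertonDyer.Rank1Residual.X11b

variable {K : Type} [Field K] [NumberField K]

/-! ## §1 Every automorphism of `K[n]` moving `K` is an involution -/

/-- **Every element of `Aut_ℚ(K[n]) ∖ 𝒢_n` is an involution** (`n ≠ 0`): `Gal(K[n]/ℚ) = 𝒢_n ⋊ ⟨τ⟩` with `τ` complex conjugation
acting on the abelian `𝒢_n` by inversion, so `(τ g)² = (τ g τ⁻¹) g = g⁻¹ g = 1`. [cite: Cox2013, §9.A Lemma 9.3]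
[cite: GrossLMS1991, §3 (τ an involution of K_n)] -/
theorem mul_self_eq_one_of_not_mem_ringClassGal (hK : IsImaginaryQuadratic K) (ι : K →+* ℂ) {n : ℕ} (hn : n ≠ 0)
    {σ : ringClassField K ι n ≃ₐ[ℚ] ringClassField K ι n} (hσ : σ ∉ ringClassGal ι n) : σ * σ = 1 := by
  obtain ⟨τ, hτ⟩ := RingClassConj.exists_conj_algEquiv hK ι hn
  have hτG : τ ∉ ringClassGal ι n := RingClassConj.conj_not_mem_ringClassGal hτ hK
  rcases RingClassConj.mem_ringClassGal_or_conj_mul_mem hτ hK σ with h | h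
  · exact absurd h hσ
  · have h1 : σ = τ * (τ * σ) := by rw [← mul_assoc, RingClassConj.conj_mul_self hτ, one_mul]
    have h2 : τ * (τ * σ) * τ⁻¹ = (τ * σ)⁻¹ := mul_mul_inv_eq_inv_of_not_mem_ringClassGal hK ι hn hτG h
    rw [RingClassConj.conj_inv hτ] at h2
    calc σ * σ = τ * (τ * σ) * τ * (τ * σ) := by
          conv_lhs => rw [h1]
          simp only [mul_assoc]
      _ = (τ * σ)⁻¹ * (τ * σ) := by rw [h2]
      _ = 1 := inv_mul_cancel _

/-! ## §2 Gross's Frobenius lift fixes `K[ℓ]` -/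

/-- **Gross's Frobenius lift at a prime inert in `K` fixes the ring class field.** Let `h ∈ Γ_ℚ` restrict on `K` to `c ≠ 1` (its transport
`t = absGaloisTransport h` to `K̄` is a lift of `c`) and let `F ∈ Γ_K` have `res_ℚ F = h²` (the shape of `exists_frobeniusLift_of_isKolyvaginPrime`).
Then `F ∈ ringClassStabilizer K ι ℓ ℓ`: `F` fixes `e(K[ℓ])` pointwise for every `K`-embedding `e : K[ℓ] → K̄` (`ℓ ≠ 0`).
[cite: GrossLMS1991, §3] [cite: Cox2013, §9.A Lemma 9.3] -/
theorem mem_ringClassStabilizer_of_absGaloisRestrict_eq_sq (hK : IsImaginaryQuadratic K) (ι : K →+* ℂ) {ℓ : ℕ} (hℓ : ℓ ≠ 0)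
    {c : K ≃ₐ[ℚ] K} (hc : c ≠ 1) {h : absoluteGaloisGroup ℚ}
    (ht : IsLiftOfAut c (absGaloisTransport (K := ℚ) (L := K) h).toRingEquiv) {F : absoluteGaloisGroup K}
    (hF : absGaloisRestrict ℚ K F = h ^ 2) : F ∈ ringClassStabilizer K ι ℓ ℓ := by
  rw [mem_ringClassStabilizer_iff]
  intro e x _
  -- `F = t²` on `K̄`, `t` the transport of `h`
  have hFt : ∀ y : AlgebraicClosure K,
      F • y = absGaloisTransport (K := ℚ) (L := K) h (absGaloisTransport (K := ℚ) (L := K) h y) := fun y ↦ by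
    rw [← absGaloisTransport_absGaloisRestrict (K := ℚ) F y, hF, map_pow, pow_two, AlgEquiv.mul_apply]
  -- `t ∘ e = e ∘ g₀`
  obtain ⟨g₀, hg₀⟩ := RingClassConj.exists_algEquiv_forall_apply_eq hK ι hℓ (e : ringClassField K ι ℓ →+* AlgebraicClosure K)
    ((absGaloisTransport (K := ℚ) (L := K) h : AlgebraicClosure K →+* AlgebraicClosure K).comp
      (e : ringClassField K ι ℓ →+* AlgebraicClosure K))
  have hg₀' : ∀ y : ringClassField K ι ℓ, absGaloisTransport (K := ℚ) (L := K) h (e y) = e (g₀ y) := fun y ↦ hg₀ y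
  -- `g₀` moves `K`, since `t` does
  have hg₀G : g₀ ∉ ringClassGal ι ℓ := by
    intro hmem
    apply hc
    refine AlgEquiv.ext fun k ↦ ?_
    have h1 := hg₀' (algebraMap K (ringClassField K ι ℓ) k)
    rw [smul_algebraMap_of_mem_ringClassGal hmem, AlgHom.commutes] at h1
    have h2 : absGaloisTransport (K := ℚ) (L := K) h (algebraMap K (AlgebraicClosure K) k) =
        algebraMap K (AlgebraicClosure K) (c k) := ht k
    rw [h2] at h1
    exact ((algebraMap K (AlgebraicClosure K)).injective h1)
  -- `g₀² = 1`, hence `F (e x) = e (g₀² x) = e x`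
  have hinv : g₀ * g₀ = 1 := mul_self_eq_one_of_not_mem_ringClassGal hK ι hℓ hg₀G
  rw [hFt, hg₀', hg₀', ← AlgEquiv.mul_apply, hinv, AlgEquiv.one_apply]

end Summit.BirchSwinnertonDyer.BirchSwinnertonDyer.Theorems.AdditiveKoly

end
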